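import Mathlib.Analysis.SpecialFunctions.Trigonometric.Cotangent
import Mathlib.Analysis.SpecialFunctions.Trigonometric.DerivHyp
import Mathlib.NumberTheory.ZetaValues
import HarnessLib

/-!
# Partial fraction expansions of `coth`, `tanh` and the logistic function

Classical Mittag-Leffler (partial fraction) expansions on the real line:

* `Literature.Analysis.SpecialFunctions.hasSum_coth_sub_inv` — `coth x - 1/x = ∑_{n ≥ 1} 2x / (x² + n²π²)` for real `x ≠ 0`
  (Andrews–Askey–Roy, *Special Functions*, (1.2.5): `π cot πx = 1/x + ∑ (1/(x+n) + 1/(x-n))`,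
  at imaginary argument);
* `Literature.Analysis.SpecialFunctions.hasSum_tanh` — `tanh x = ∑_{k ≥ 0} 8x / (4x² + (2k+1)²π²)` for all real `x`, from
  `tanh x = 2 coth 2x - coth x`;
* `Literature.Analysis.SpecialFunctions.one_div_one_add_exp` — the logistic function `1/(1 + eˣ) = 1/2 - tanh(x/2)/2`, whence
  (`Literature.Analysis.SpecialFunctions.hasSum_one_div_one_add_exp`) `1/(1 + eˣ) = 1/2 - ∑_{k ≥ 0} 2x / (x² + (2k+1)²π²)`;
* `Literature.Analysis.SpecialFunctions.hasSum_one_div_odd_sq` — `∑_{k ≥ 0} 1/(2k+1)² = π²/8` (Euler; the odd part of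
  `ζ(2) = π²/6`, `hasSum_zeta_two`).

These are the inputs for the term-wise integration of the Fermi factor `1/(1 + e^{ωU/2})` in the
Lieb–Wu charge-gap integral (`Literature.Analysis.FunctionSpaces.LiebWuChargeGapProofs`).

## Proofs

Mathlib proves the Mittag-Leffler expansion of the cotangent on `ℂ ∖ ℤ`
(`cot_series_rep'`, `summable_cotTerm`:
`π cot(πz) - 1/z = ∑_{n ≥ 0} (1/(z - (n+1)) + 1/(z + (n+1)))`). We evaluate it at the purely
imaginary point `z = (x/π) i` (`cot(ix) = -i coth x`) and take real parts; the `tanh` expansion is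
the difference of the expansions of `2 coth 2x` (all indices `m ≥ 0` of `8x/(4x² + (m+1)²π²)`) and
of `coth x` (the odd indices `m = 2k+1`), leaving the even ones (`HasSum.even_add_odd`); the
odd-square sum is `ζ(2)` minus its even part `ζ(2)/4`.

## References

* G. E. Andrews, R. Askey, R. Roy, *Special Functions* (Cambridge, 1999), §1.2, eq. (1.2.5)
  (partial fractions for `π cot πx`, the logarithmic derivative of the product formula (1.2.4) for
  `sin πx`).
-/

noncomputable section

open Filter Complex Real

namespace Literature.Analysis.SpecialFunctions

/-! ## The expansion of `coth x - 1/x` from Mathlib's cotangent expansion -/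

/-- For real `x ≠ 0` the purely imaginary point `(x/π) i` is not an integer. [folklore] -/
theorem ofReal_div_pi_mul_I_mem_integerComplement {x : ℝ} (hx : x ≠ 0) :
    ((x / π : ℝ) : ℂ) * I ∈ Complex.integerComplement := by
  rw [Complex.mem_integerComplement_iff]
  rintro ⟨n, hn⟩
  have h := congrArg Complex.im hn
  simp only [Complex.intCast_im, Complex.mul_im, Complex.ofReal_re, Complex.I_im, mul_one,
    Complex.ofReal_im, Complex.I_re, mul_zero, add_zero] at h
  exact hx (by simpa [Real.pi_ne_zero] using h.symm)

/-- The terms of Mathlib's cotangent expansion at `z = (x/π) i`, rotated back to the real line: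
`(i/π) (1/(z - (n+1)) + 1/(z + (n+1))) = 2x / (x² + (n+1)²π²)`. [folklore] -/
theorem I_div_pi_mul_cotTerm (x : ℝ) (n : ℕ) :
    I / π * cotTerm (((x / π : ℝ) : ℂ) * I) n =
      ((2 * x / (x ^ 2 + (n + 1) ^ 2 * π ^ 2) : ℝ) : ℂ) := by
  have hπ : (π : ℂ) ≠ 0 := ofReal_ne_zero.mpr Real.pi_ne_zero
  have hI : (I : ℂ) ≠ 0 := Complex.I_ne_zero
  have h1 : ((x / π : ℝ) : ℂ) * I - (n + 1) ≠ 0 := fun h => by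
    have := congrArg Complex.re h
    simp at this
    linarith [n.cast_nonneg (α := ℝ)]
  have h2 : ((x / π : ℝ) : ℂ) * I + (n + 1) ≠ 0 := fun h => by
    have := congrArg Complex.re h
    simp at this
    linarith [n.cast_nonneg (α := ℝ)]
  have hprod : (((x / π : ℝ) : ℂ) * I - (n + 1)) * (((x / π : ℝ) : ℂ) * I + (n + 1)) =
      -(((x : ℂ) ^ 2 + ((n : ℂ) + 1) ^ 2 * π ^ 2) / π ^ 2) := by
    push_cast
    field_simp
    linear_combination (x : ℂ) ^ 2 * Complex.I_sq
  have hsum : ((x / π : ℝ) : ℂ) * I - (n + 1) + (((x / π : ℝ) : ℂ) * I + (n + 1)) =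
      2 * (((x / π : ℝ) : ℂ) * I) := by ring
  simp only [cotTerm]
  rw [one_div_add_one_div h1 h2, hprod, hsum]
  push_cast
  rw [div_neg, div_div_eq_mul_div]
  field_simp
  rw [Complex.I_sq]
  ring

/-- **Partial fraction expansion of the hyperbolic cotangent**: for real `x ≠ 0`,
`coth x - 1/x = ∑_{n ≥ 0} 2x / (x² + (n+1)²π²)` (Andrews–Askey–Roy (1.2.5),
`π cot πx = 1/x + ∑_{n ≥ 1} (1/(x+n) + 1/(x-n))`, at `x ↦ ix/π`). [cite: AndrewsAskeyRoy1999, §1.2 (1.2.5)] -/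
theorem hasSum_coth_sub_inv {x : ℝ} (hx : x ≠ 0) :
    HasSum (fun n : ℕ => 2 * x / (x ^ 2 + (n + 1) ^ 2 * π ^ 2))
      (Real.cosh x / Real.sinh x - 1 / x) := by
  have hπ : (π : ℂ) ≠ 0 := ofReal_ne_zero.mpr Real.pi_ne_zero
  have hI : (I : ℂ) ≠ 0 := Complex.I_ne_zero
  have hxC : (x : ℂ) ≠ 0 := ofReal_ne_zero.mpr hx
  have hsinh : (Real.sinh x : ℂ) ≠ 0 := ofReal_ne_zero.mpr (Real.sinh_ne_zero.mpr hx)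
  have hzC : ((x / π : ℝ) : ℂ) * I ∈ Complex.integerComplement :=
    ofReal_div_pi_mul_I_mem_integerComplement hx
  -- Mathlib's expansion, as a `HasSum` in `ℂ`
  have h1 : HasSum (fun n : ℕ => cotTerm (((x / π : ℝ) : ℂ) * I) n)
      (π * Complex.cot (π * (((x / π : ℝ) : ℂ) * I)) - 1 / (((x / π : ℝ) : ℂ) * I)) := by
    rw [cot_series_rep' hzC]
    exact (summable_cotTerm hzC).hasSum
  have h2 := h1.mul_left (I / π)
  simp only [I_div_pi_mul_cotTerm] at h2
  -- the value: `(i/π) (π cot(π z) - 1/z) = coth x - 1/x` at `z = (x/π) i`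
  have hval : I / π * (π * Complex.cot (π * (((x / π : ℝ) : ℂ) * I)) - 1 / (((x / π : ℝ) : ℂ) * I)) =
      ((Real.cosh x / Real.sinh x - 1 / x : ℝ) : ℂ) := by
    have hπz : (π : ℂ) * (((x / π : ℝ) : ℂ) * I) = (x : ℂ) * I := by
      push_cast; field_simp
    rw [hπz, Complex.cot_eq_cos_div_sin, Complex.cos_mul_I, Complex.sin_mul_I,
      ← Complex.ofReal_cosh, ← Complex.ofReal_sinh]
    push_cast
    field_simp
  rw [hval] at h2
  exact_mod_cast h2

/-! ## The expansion of `tanh` -/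

/-- `tanh x = 2 coth 2x - coth x` for real `x ≠ 0`. [folklore] -/
theorem tanh_eq_two_mul_coth_two_mul_sub {x : ℝ} (hx : x ≠ 0) :
    Real.tanh x = 2 * (Real.cosh (2 * x) / Real.sinh (2 * x)) - Real.cosh x / Real.sinh x := by
  have hs : Real.sinh x ≠ 0 := Real.sinh_ne_zero.mpr hx
  have hc : Real.cosh x ≠ 0 := (Real.cosh_pos x).ne'
  rw [Real.cosh_two_mul, Real.sinh_two_mul, Real.tanh_eq_sinh_div_cosh]
  field_simp
  ring

/-- **Partial fraction expansion of the hyperbolic tangent**: for every real `x`,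
`tanh x = ∑_{k ≥ 0} 8x / (4x² + (2k+1)²π²)` (from `tanh x = 2 coth 2x - coth x` and the
expansion of `coth`, i.e. Andrews–Askey–Roy (1.2.5) at imaginary argument). [cite: AndrewsAskeyRoy1999, §1.2 (1.2.5)] -/
theorem hasSum_tanh (x : ℝ) :
    HasSum (fun k : ℕ => 8 * x / (4 * x ^ 2 + (2 * k + 1) ^ 2 * π ^ 2)) (Real.tanh x) := by
  rcases eq_or_ne x 0 with rfl | hx
  · simp [hasSum_zero]
  -- `f m = 8x / (4x² + (m+1)²π²)`: all indices give `2 coth 2x - 1/x`, odd ones `coth x - 1/x`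
  set f : ℕ → ℝ := fun m => 8 * x / (4 * x ^ 2 + (m + 1) ^ 2 * π ^ 2) with hf
  have hall : HasSum f (2 * (Real.cosh (2 * x) / Real.sinh (2 * x)) - 1 / x) := by
    have h := (hasSum_coth_sub_inv (mul_ne_zero two_ne_zero hx)).mul_left 2
    have hv : 2 * (Real.cosh (2 * x) / Real.sinh (2 * x) - 1 / (2 * x)) =
        2 * (Real.cosh (2 * x) / Real.sinh (2 * x)) - 1 / x := by
      field_simp
    rw [hv] at h
    refine h.congr_fun fun m => ?_
    simp only [hf]
    have hden : (0 : ℝ) < 4 * x ^ 2 + ((m : ℝ) + 1) ^ 2 * π ^ 2 := by positivity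
    field_simp
    ring
  have hodd : HasSum (fun k : ℕ => f (2 * k + 1)) (Real.cosh x / Real.sinh x - 1 / x) := by
    refine (hasSum_coth_sub_inv hx).congr_fun fun k => ?_
    simp only [hf]
    have hden : (0 : ℝ) < x ^ 2 + ((k : ℝ) + 1) ^ 2 * π ^ 2 := by positivity
    push_cast
    field_simp
    ring
  have heven : Summable fun k : ℕ => f (2 * k) :=
    hall.summable.comp_injective (mul_right_injective₀ two_ne_zero)
  have hsplit := heven.hasSum.even_add_odd hodd
  have huniq : (∑' k, f (2 * k)) + (Real.cosh x / Real.sinh x - 1 / x) =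
      2 * (Real.cosh (2 * x) / Real.sinh (2 * x)) - 1 / x := hsplit.unique hall
  have hT : ∑' k, f (2 * k) = Real.tanh x := by
    rw [tanh_eq_two_mul_coth_two_mul_sub hx]
    linarith
  rw [← hT]
  refine heven.hasSum.congr_fun fun k => ?_
  simp only [hf]
  push_cast
  ring_nf

/-! ## The logistic function -/

/-- The logistic (Fermi) function in terms of `tanh`: `1/(1 + eˣ) = 1/2 - tanh(x/2)/2`. [folklore] -/
theorem one_div_one_add_exp (x : ℝ) :
    1 / (1 + Real.exp x) = 1 / 2 - Real.tanh (x / 2) / 2 := by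
  have hu : Real.exp x = Real.exp (x / 2) * Real.exp (x / 2) := by
    rw [← Real.exp_add]; ring_nf
  have hpos : 0 < Real.exp (x / 2) := Real.exp_pos _
  rw [Real.tanh_eq_sinh_div_cosh, Real.sinh_eq, Real.cosh_eq, Real.exp_neg, hu]
  field_simp
  ring

/-- **Partial fraction expansion of the logistic function**: for every real `x`,
`∑_{k ≥ 0} 2x / (x² + (2k+1)²π²) = 1/2 - 1/(1 + eˣ)` (the expansion of `tanh (x/2) / 2`, from
Andrews–Askey–Roy (1.2.5)). [cite: AndrewsAskeyRoy1999, §1.2 (1.2.5)] -/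
theorem hasSum_one_div_one_add_exp (x : ℝ) :
    HasSum (fun k : ℕ => 2 * x / (x ^ 2 + (2 * k + 1) ^ 2 * π ^ 2))
      (1 / 2 - 1 / (1 + Real.exp x)) := by
  have h := (hasSum_tanh (x / 2)).div_const 2
  rw [one_div_one_add_exp, sub_sub_cancel]
  refine h.congr_fun fun k => ?_
  have hden : (0 : ℝ) < x ^ 2 + (2 * (k : ℝ) + 1) ^ 2 * π ^ 2 := by positivity
  field_simp
  ring

/-! ## `∑ 1/(2k+1)² = π²/8` -/

/-- **Euler's odd-square sum**: `∑_{k ≥ 0} 1/(2k+1)² = π²/8`, the odd part of `ζ(2) = π²/6`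
(the even part being `ζ(2)/4`). [folklore] -/
theorem hasSum_one_div_odd_sq :
    HasSum (fun k : ℕ => 1 / (2 * (k : ℝ) + 1) ^ 2) (π ^ 2 / 8) := by
  set f : ℕ → ℝ := fun n => 1 / (n : ℝ) ^ 2 with hf
  have hall : HasSum f (π ^ 2 / 6) := hasSum_zeta_two
  have heven : HasSum (fun k : ℕ => f (2 * k)) (1 / 4 * (π ^ 2 / 6)) := by
    refine (hasSum_zeta_two.mul_left (1 / 4)).congr_fun fun k => ?_
    simp only [hf]
    push_cast
    ring
  have hodd : Summable fun k : ℕ => f (2 * k + 1) :=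
    hall.summable.comp_injective
      ((add_left_injective 1).comp (mul_right_injective₀ two_ne_zero))
  have hsplit := heven.even_add_odd hodd.hasSum
  have huniq : 1 / 4 * (π ^ 2 / 6) + ∑' k, f (2 * k + 1) = π ^ 2 / 6 := hsplit.unique hall
  have hT : ∑' k, f (2 * k + 1) = π ^ 2 / 8 := by linarith
  rw [← hT]
  refine hodd.hasSum.congr_fun fun k => ?_
  simp only [hf]
  push_cast
  ring_nf

end Literature.Analysis.SpecialFunctions
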